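import Literature.Probability.LatticeModels.SpinWaveComplexStabilityTorus
import Summits.HubbardSuperconductivity.HubbardSuperconductivity.Theorems.NodalWardXYDefs
import Summits.HubbardSuperconductivity.HubbardSuperconductivity.Theorems.NodalWardXYPerturbedXYOrderFixedVolume
import Summits.HubbardSuperconductivity.HubbardSuperconductivity.Theorems.NodalWardXYPerturbedXYOrderTwistEvenResponse

/-!
# `PerturbedXYOrder` (stmt-HubbardSuperconductivity-10739) — line `schwarz-inheritance`, stub `stub_twistLipschitz`

**Twist decoupling of admissible two-current tilts, II: the Lipschitz bound in the energy norm.**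
For a kernel `K` admissible at radius `ε` (`‖K(b,b')‖ ≤ ε(1+dist)⁻⁴`), every angle configuration `θ`
and every site-dependent rotation `g` of the torus `(ℤ/Lℤ)³`,

  `‖W_K(θ + g) − W_K(θ)‖ ≤ 288 ε Σ_b (1 − cos ∇_b g) + 576 ε √(Σ_b (1 − cos ∇_bθ)) √(Σ_b (1 − cos ∇_b g))`,

where `W_K(θ) = Σ_{b,b'} K(b,b') sin ∇_bθ sin ∇_{b'}θ` (`Wk`).  Per pair of bonds, with `a = ∇_bθ`,
`a' = ∇_{b'}θ`, `u = ∇_b g`, `u' = ∇_{b'} g`, `sin(a+u) sin(a'+u') − sin a sin a' = E + O`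
(`tlz_pair_identity`) with the part even in the twist
`E = sin a sin a' (cos u cos u' − 1) + cos a cos a' sin u sin u'`, `|E| ≤ (1 − cos u) + (1 − cos u')`
(`ter_pair_bound` of the companion file `…TwistEvenResponse.lean`, stub `stub_twistEvenResponse`), and the odd part
`O = sin a cos a' cos u sin u' + cos a sin a' sin u cos u'`, `|O| ≤ |sin a| |sin u'| + |sin u| |sin a'|`
(`tlz_odd_bound`).  Summed against `‖K‖`, whose row and column sums are `≤ 144 ε`
(`row_sum_norm_le_of_admissible`, `col_sum_norm_le_of_admissible`), the even part gives
`288 ε Σ_b (1 − cos ∇_b g)` and each of the two odd terms gives, by the weighted Cauchy–Schwarz inequality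
for a kernel with bounded row and column sums (`tlz_weighted_cauchy_schwarz`) and `sin² ≤ 2 (1 − cos)`,
`144 ε √(2 Σ_b (1 − cos ∇_bθ)) √(2 Σ_b (1 − cos ∇_b g))` (`tlz_kernel_bound`).
-/

noncomputable section

namespace Summit.HubbardSuperconductivity.HubbardSuperconductivity.Theorems.PerturbedXYOrder

open MeasureTheory Literature.Probability.LatticeModels
open Summit.HubbardSuperconductivity.HubbardSuperconductivity.Theses.NodalWardXY

variable {L : ℕ}

/-! ### Per-pair trigonometry -/

/-- The twist of a product of two sines, split into its parts even and odd in the twist: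
`sin(a+u) sin(a'+u') − sin a sin a' = [sin a sin a' (cos u cos u' − 1) + cos a cos a' sin u sin u']
  + [sin a cos a' cos u sin u' + cos a sin a' sin u cos u']`. -/
theorem tlz_pair_identity (a a' u u' : ℝ) :
    Real.sin (a + u) * Real.sin (a' + u') - Real.sin a * Real.sin a' =
      (Real.sin a * Real.sin a' * (Real.cos u * Real.cos u' - 1) +
          Real.cos a * Real.cos a' * (Real.sin u * Real.sin u')) +
        (Real.sin a * Real.cos a' * Real.cos u * Real.sin u' +
          Real.cos a * Real.sin a' * Real.sin u * Real.cos u') := by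
  simp only [Real.sin_add]
  ring

/-- `|x p q y| ≤ |x| |y|` when `|p|, |q| ≤ 1`. -/
theorem tlz_abs_mul_four_le {x p q y : ℝ} (hp : |p| ≤ 1) (hq : |q| ≤ 1) :
    |x * p * q * y| ≤ |x| * |y| := by
  rw [abs_mul, abs_mul, abs_mul]
  calc |x| * |p| * |q| * |y| = (|x| * |y|) * (|p| * |q|) := by ring
    _ ≤ (|x| * |y|) * 1 :=
        mul_le_mul_of_nonneg_left (mul_le_one₀ hp (abs_nonneg _) hq)
          (mul_nonneg (abs_nonneg _) (abs_nonneg _))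
    _ = |x| * |y| := mul_one _

/-- **The odd part**: `|sin a cos a' cos u sin u' + cos a sin a' sin u cos u'| ≤ |sin a| |sin u'| + |sin u| |sin a'|`. -/
theorem tlz_odd_bound (a a' u u' : ℝ) :
    |Real.sin a * Real.cos a' * Real.cos u * Real.sin u' +
        Real.cos a * Real.sin a' * Real.sin u * Real.cos u'| ≤
      |Real.sin a| * |Real.sin u'| + |Real.sin u| * |Real.sin a'| := by
  refine (abs_add_le _ _).trans (add_le_add ?_ ?_)
  · exact tlz_abs_mul_four_le (Real.abs_cos_le_one a') (Real.abs_cos_le_one u)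
  · rw [show Real.cos a * Real.sin a' * Real.sin u * Real.cos u' =
        Real.sin u * Real.cos a * Real.cos u' * Real.sin a' by ring]
    exact tlz_abs_mul_four_le (Real.abs_cos_le_one a) (Real.abs_cos_le_one u')

/-! ### Kernel sums -/

/-- **Weighted Cauchy–Schwarz for a kernel with bounded row and column sums**: if `w ≥ 0` on `ι × ι`
has all row sums and all column sums at most `c ≥ 0`, and `Σ_i x_i² ≤ X`, `Σ_j y_j² ≤ Y`, then
`Σ_{i,j} w(i,j) |x_i| |y_j| ≤ c √X √Y`. -/
theorem tlz_weighted_cauchy_schwarz {ι : Type*} [Fintype ι] {w : ι → ι → ℝ} (hw : ∀ i j, 0 ≤ w i j)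
    {c : ℝ} (hc : 0 ≤ c) (hrow : ∀ i, ∑ j, w i j ≤ c) (hcol : ∀ j, ∑ i, w i j ≤ c)
    {x y : ι → ℝ} {X Y : ℝ} (hX : ∑ i, x i ^ 2 ≤ X) (hY : ∑ j, y j ^ 2 ≤ Y) :
    ∑ i, ∑ j, w i j * (|x i| * |y j|) ≤ c * (Real.sqrt X * Real.sqrt Y) := by
  have hterm : ∀ i j, w i j * (|x i| * |y j|) =
      Real.sqrt (w i j * x i ^ 2) * Real.sqrt (w i j * y j ^ 2) := by
    intro i j
    rw [Real.sqrt_mul (hw i j), Real.sqrt_mul (hw i j), Real.sqrt_sq_eq_abs, Real.sqrt_sq_eq_abs]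
    calc w i j * (|x i| * |y j|) = (Real.sqrt (w i j) * Real.sqrt (w i j)) * (|x i| * |y j|) := by
          rw [Real.mul_self_sqrt (hw i j)]
      _ = Real.sqrt (w i j) * |x i| * (Real.sqrt (w i j) * |y j|) := by ring
  have hrowsum : ∑ i, ∑ j, w i j * x i ^ 2 ≤ c * X :=
    calc ∑ i, ∑ j, w i j * x i ^ 2 = ∑ i, (∑ j, w i j) * x i ^ 2 := by simp only [Finset.sum_mul]
      _ ≤ ∑ i, c * x i ^ 2 :=
          Finset.sum_le_sum fun i _ => mul_le_mul_of_nonneg_right (hrow i) (sq_nonneg _)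
      _ = c * ∑ i, x i ^ 2 := by rw [Finset.mul_sum]
      _ ≤ c * X := mul_le_mul_of_nonneg_left hX hc
  have hcolsum : ∑ i, ∑ j, w i j * y j ^ 2 ≤ c * Y :=
    calc ∑ i, ∑ j, w i j * y j ^ 2 = ∑ j, (∑ i, w i j) * y j ^ 2 := by
          rw [Finset.sum_comm]; simp only [Finset.sum_mul]
      _ ≤ ∑ j, c * y j ^ 2 :=
          Finset.sum_le_sum fun j _ => mul_le_mul_of_nonneg_right (hcol j) (sq_nonneg _)
      _ = c * ∑ j, y j ^ 2 := by rw [Finset.mul_sum]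
      _ ≤ c * Y := mul_le_mul_of_nonneg_left hY hc
  calc ∑ i, ∑ j, w i j * (|x i| * |y j|)
      = ∑ i, ∑ j, Real.sqrt (w i j * x i ^ 2) * Real.sqrt (w i j * y j ^ 2) := by simp only [hterm]
    _ ≤ ∑ i, Real.sqrt (∑ j, w i j * x i ^ 2) * Real.sqrt (∑ j, w i j * y j ^ 2) :=
        Finset.sum_le_sum fun i _ => Real.sum_sqrt_mul_sqrt_le _
          (fun j => mul_nonneg (hw i j) (sq_nonneg (x i))) (fun j => mul_nonneg (hw i j) (sq_nonneg (y j)))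
    _ ≤ Real.sqrt (∑ i, ∑ j, w i j * x i ^ 2) * Real.sqrt (∑ i, ∑ j, w i j * y j ^ 2) :=
        Real.sum_sqrt_mul_sqrt_le _
          (fun i => Finset.sum_nonneg fun j _ => mul_nonneg (hw i j) (sq_nonneg (x i)))
          (fun i => Finset.sum_nonneg fun j _ => mul_nonneg (hw i j) (sq_nonneg (y j)))
    _ ≤ Real.sqrt (c * X) * Real.sqrt (c * Y) :=
        mul_le_mul (Real.sqrt_le_sqrt hrowsum) (Real.sqrt_le_sqrt hcolsum) (Real.sqrt_nonneg _)
          (Real.sqrt_nonneg _)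
    _ = c * (Real.sqrt X * Real.sqrt Y) := by
        rw [Real.sqrt_mul hc, Real.sqrt_mul hc]
        calc Real.sqrt c * Real.sqrt X * (Real.sqrt c * Real.sqrt Y)
            = (Real.sqrt c * Real.sqrt c) * (Real.sqrt X * Real.sqrt Y) := by ring
          _ = c * (Real.sqrt X * Real.sqrt Y) := by rw [Real.mul_self_sqrt hc]

/-- **Kernel form of the twist bound.**  For a nonnegative kernel `w` on `ι × ι` whose row and column sums
are at most `c ≥ 0`, and angle increments `a u : ι → ℝ`,
`Σ_{i,j} w(i,j) |sin(a_i+u_i) sin(a_j+u_j) − sin a_i sin a_j| ≤ 2c Σ_i (1 − cos u_i) + 4c √(Σ_i (1 − cos a_i)) √(Σ_i (1 − cos u_i))`. -/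
theorem tlz_kernel_bound {ι : Type*} [Fintype ι] (w : ι → ι → ℝ) (hw : ∀ i j, 0 ≤ w i j) {c : ℝ}
    (hc : 0 ≤ c) (hrow : ∀ i, ∑ j, w i j ≤ c) (hcol : ∀ j, ∑ i, w i j ≤ c) (a u : ι → ℝ) :
    ∑ i, ∑ j, w i j * |Real.sin (a i + u i) * Real.sin (a j + u j) - Real.sin (a i) * Real.sin (a j)| ≤
      2 * c * ∑ i, (1 - Real.cos (u i)) +
        4 * c * (Real.sqrt (∑ i, (1 - Real.cos (a i))) * Real.sqrt (∑ i, (1 - Real.cos (u i)))) := by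
  set M : ℝ := ∑ i, (1 - Real.cos (u i)) with hM
  set E : ℝ := ∑ i, (1 - Real.cos (a i)) with hE
  -- per-pair bound
  have hper : ∀ i j, |Real.sin (a i + u i) * Real.sin (a j + u j) - Real.sin (a i) * Real.sin (a j)| ≤
      ((1 - Real.cos (u i)) + (1 - Real.cos (u j))) +
        (|Real.sin (a i)| * |Real.sin (u j)| + |Real.sin (u i)| * |Real.sin (a j)|) := by
    intro i j
    rw [tlz_pair_identity]
    exact (abs_add_le _ _).trans (add_le_add (ter_pair_bound _ _ _ _) (tlz_odd_bound _ _ _ _))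
  -- the even part: row and column sums
  have heven : ∑ i, ∑ j, w i j * ((1 - Real.cos (u i)) + (1 - Real.cos (u j))) ≤ 2 * c * M := by
    have h0 : ∀ i, 0 ≤ 1 - Real.cos (u i) := fun i => sub_nonneg.2 (Real.cos_le_one _)
    calc ∑ i, ∑ j, w i j * ((1 - Real.cos (u i)) + (1 - Real.cos (u j)))
        = ∑ i, (∑ j, w i j) * (1 - Real.cos (u i)) + ∑ j, (∑ i, w i j) * (1 - Real.cos (u j)) := by
          simp only [mul_add, Finset.sum_add_distrib, Finset.sum_mul]
          congr 1
          exact Finset.sum_comm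
      _ ≤ ∑ i, c * (1 - Real.cos (u i)) + ∑ j, c * (1 - Real.cos (u j)) :=
          add_le_add (Finset.sum_le_sum fun i _ => mul_le_mul_of_nonneg_right (hrow i) (h0 i))
            (Finset.sum_le_sum fun j _ => mul_le_mul_of_nonneg_right (hcol j) (h0 j))
      _ = 2 * c * M := by rw [← Finset.mul_sum, ← hM]; ring
  -- the odd parts: weighted Cauchy–Schwarz and `sin² ≤ 2 (1 - cos)`
  have hsa : ∑ i, Real.sin (a i) ^ 2 ≤ 2 * E := by
    rw [hE, Finset.mul_sum]; exact Finset.sum_le_sum fun i _ => fv_sin_sq_le _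
  have hsu : ∑ i, Real.sin (u i) ^ 2 ≤ 2 * M := by
    rw [hM, Finset.mul_sum]; exact Finset.sum_le_sum fun i _ => fv_sin_sq_le _
  have h2 : Real.sqrt (2 * E) * Real.sqrt (2 * M) = 2 * (Real.sqrt E * Real.sqrt M) := by
    rw [Real.sqrt_mul zero_le_two, Real.sqrt_mul zero_le_two]
    calc Real.sqrt 2 * Real.sqrt E * (Real.sqrt 2 * Real.sqrt M)
        = (Real.sqrt 2 * Real.sqrt 2) * (Real.sqrt E * Real.sqrt M) := by ring
      _ = 2 * (Real.sqrt E * Real.sqrt M) := by rw [Real.mul_self_sqrt zero_le_two]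
  have hodd1 : ∑ i, ∑ j, w i j * (|Real.sin (a i)| * |Real.sin (u j)|) ≤
      c * (2 * (Real.sqrt E * Real.sqrt M)) := by
    have h := tlz_weighted_cauchy_schwarz hw hc hrow hcol hsa hsu
    rwa [h2] at h
  have hodd2 : ∑ i, ∑ j, w i j * (|Real.sin (u i)| * |Real.sin (a j)|) ≤
      c * (2 * (Real.sqrt E * Real.sqrt M)) := by
    have h := tlz_weighted_cauchy_schwarz hw hc hrow hcol hsu hsa
    rwa [mul_comm (Real.sqrt (2 * M)), h2] at h
  calc ∑ i, ∑ j, w i j * |Real.sin (a i + u i) * Real.sin (a j + u j) - Real.sin (a i) * Real.sin (a j)|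
      ≤ ∑ i, ∑ j, w i j * (((1 - Real.cos (u i)) + (1 - Real.cos (u j))) +
          (|Real.sin (a i)| * |Real.sin (u j)| + |Real.sin (u i)| * |Real.sin (a j)|)) :=
        Finset.sum_le_sum fun i _ => Finset.sum_le_sum fun j _ =>
          mul_le_mul_of_nonneg_left (hper i j) (hw i j)
    _ = ∑ i, ∑ j, w i j * ((1 - Real.cos (u i)) + (1 - Real.cos (u j))) +
          (∑ i, ∑ j, w i j * (|Real.sin (a i)| * |Real.sin (u j)|) +
            ∑ i, ∑ j, w i j * (|Real.sin (u i)| * |Real.sin (a j)|)) := by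
        simp only [mul_add, Finset.sum_add_distrib]
    _ ≤ 2 * c * M + (c * (2 * (Real.sqrt E * Real.sqrt M)) + c * (2 * (Real.sqrt E * Real.sqrt M))) :=
        add_le_add heven (add_le_add hodd1 hodd2)
    _ = 2 * c * M + 4 * c * (Real.sqrt E * Real.sqrt M) := by ring

/-! ### The twisted perturbation -/

/-- The twist response of `W_K` as a kernel sum of the per-pair responses. -/
theorem tlz_sub_eq [NeZero L] (K : Bond L → Bond L → ℂ) (θ g : TorusSite 3 L → ℝ) :
    Wk K (θ + g) - Wk K θ =
      ∑ b : Bond L, ∑ b' : Bond L,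
        K b b' * ((cur b (θ + g) * cur b' (θ + g) - cur b θ * cur b' θ : ℝ) : ℂ) := by
  unfold Wk
  rw [← Finset.sum_sub_distrib]
  refine Finset.sum_congr rfl fun b _ => ?_
  rw [← Finset.sum_sub_distrib]
  refine Finset.sum_congr rfl fun b' _ => ?_
  push_cast
  ring

/-- STUB `stub_twistLipschitz` (registered on stmt-HubbardSuperconductivity-10739, line `schwarz-inheritance`):
**an admissible two-current tilt is Lipschitz under site-dependent rotations, in the energy norm.**
For `K` admissible at radius `ε`, every configuration `θ` and every site-dependent rotation `g` of `(ℤ/Lℤ)³`,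
`‖W_K(θ+g) − W_K(θ)‖ ≤ 288 ε Σ_b (1 − cos ∇_b g) + 576 ε √(Σ_b (1 − cos ∇_bθ)) √(Σ_b (1 − cos ∇_b g))`
(per-pair even/odd split `tlz_pair_identity`, `ter_pair_bound`, `tlz_odd_bound`; row and column sums of
`‖K‖` at most `144 ε`; weighted Cauchy–Schwarz `tlz_weighted_cauchy_schwarz`; `sin² ≤ 2(1 − cos)`). [folklore] -/
theorem stub_twistLipschitz : ∀ (L : ℕ) [NeZero L] (ε : ℝ) (K : Bond L → Bond L → ℂ), Admissible L ε K →
    ∀ θ g : TorusSite 3 L → ℝ,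
      ‖Wk K (θ + g) - Wk K θ‖ ≤
        288 * ε * ∑ b : Bond L, (1 - Real.cos (g (b.1 + Pi.single b.2 1) - g b.1)) +
          576 * ε * (Real.sqrt (∑ b : Bond L, (1 - Real.cos (θ (b.1 + Pi.single b.2 1) - θ b.1))) *
            Real.sqrt (∑ b : Bond L, (1 - Real.cos (g (b.1 + Pi.single b.2 1) - g b.1)))) := by
  intro L _ ε K hK θ g
  have hrow : ∀ b : Bond L, ∑ b', ‖K b b'‖ ≤ 144 * ε := row_sum_norm_le_of_admissible K hK
  have hcol : ∀ b' : Bond L, ∑ b, ‖K b b'‖ ≤ 144 * ε := col_sum_norm_le_of_admissible K hK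
  have hc : 0 ≤ 144 * ε :=
    (Finset.sum_nonneg fun _ _ => norm_nonneg _).trans (hrow ((fun _ => 0), 0))
  -- the kernel bound with `w = ‖K‖`, `c = 144 ε`, `a = ∇θ`, `u = ∇g`
  have key : ∑ b : Bond L, ∑ b' : Bond L, ‖K b b'‖ *
      |Real.sin ((θ (b.1 + Pi.single b.2 1) - θ b.1) + (g (b.1 + Pi.single b.2 1) - g b.1)) *
          Real.sin ((θ (b'.1 + Pi.single b'.2 1) - θ b'.1) + (g (b'.1 + Pi.single b'.2 1) - g b'.1)) -
        Real.sin (θ (b.1 + Pi.single b.2 1) - θ b.1) * Real.sin (θ (b'.1 + Pi.single b'.2 1) - θ b'.1)| ≤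
      2 * (144 * ε) * ∑ b : Bond L, (1 - Real.cos (g (b.1 + Pi.single b.2 1) - g b.1)) +
        4 * (144 * ε) * (Real.sqrt (∑ b : Bond L, (1 - Real.cos (θ (b.1 + Pi.single b.2 1) - θ b.1))) *
          Real.sqrt (∑ b : Bond L, (1 - Real.cos (g (b.1 + Pi.single b.2 1) - g b.1)))) :=
    tlz_kernel_bound (fun b b' : Bond L => ‖K b b'‖) (fun _ _ => norm_nonneg _) hc hrow hcol
      (fun b : Bond L => θ (b.1 + Pi.single b.2 1) - θ b.1)
      (fun b : Bond L => g (b.1 + Pi.single b.2 1) - g b.1)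
  -- `‖W_K(θ+g) − W_K(θ)‖` is at most the kernel sum
  have hle : ‖Wk K (θ + g) - Wk K θ‖ ≤ ∑ b : Bond L, ∑ b' : Bond L, ‖K b b'‖ *
      |Real.sin ((θ (b.1 + Pi.single b.2 1) - θ b.1) + (g (b.1 + Pi.single b.2 1) - g b.1)) *
          Real.sin ((θ (b'.1 + Pi.single b'.2 1) - θ b'.1) + (g (b'.1 + Pi.single b'.2 1) - g b'.1)) -
        Real.sin (θ (b.1 + Pi.single b.2 1) - θ b.1) * Real.sin (θ (b'.1 + Pi.single b'.2 1) - θ b'.1)| := by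
    rw [tlz_sub_eq]
    refine (norm_sum_le _ _).trans
      (Finset.sum_le_sum fun b _ => (norm_sum_le _ _).trans (le_of_eq (Finset.sum_congr rfl fun b' _ => ?_)))
    rw [norm_mul, Complex.norm_real, Real.norm_eq_abs, ter_cur_add, ter_cur_add]
    rfl
  calc ‖Wk K (θ + g) - Wk K θ‖ ≤ _ := hle
    _ ≤ _ := key
    _ = 288 * ε * ∑ b : Bond L, (1 - Real.cos (g (b.1 + Pi.single b.2 1) - g b.1)) +
          576 * ε * (Real.sqrt (∑ b : Bond L, (1 - Real.cos (θ (b.1 + Pi.single b.2 1) - θ b.1))) *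
            Real.sqrt (∑ b : Bond L, (1 - Real.cos (g (b.1 + Pi.single b.2 1) - g b.1)))) := by ring

end Summit.HubbardSuperconductivity.HubbardSuperconductivity.Theorems.PerturbedXYOrder

end
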